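import Literature.NumberTheory.EllipticCurves.AnalyticRankBCDTProofs
import Literature.NumberTheory.Automorphic.BCDTTheoremBOfKhareWintenberger
import HarnessLib

/-!
# `L(E, s)` is entire: the Khare–Wintenberger line of `WeierstrassCurve.hasEntireLFunction_rat`

A `…Proofs` sibling (theorems only: no definitions, no named facts, no instances) of
`Literature.NumberTheory.EllipticCurves.AnalyticRank`, written by the tenured seat of the named
fact `WeierstrassCurve.hasEntireLFunction_rat` ("for every elliptic curve `E / ℚ`, `L(E, s)` is the
restriction to `re s > 3/2` of an entire function"; Breuil–Conrad–Diamond–Taylor 2001, Thm. A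
(= Thm. 2.2.2, p. 860) with Hecke, Diamond–Shurman Thm. 8.8.3 / Thm. 5.10.2).

`AnalyticRankBCDTProofs` records the paper's own trust base {BCDT Thm. B, CDT Thm. 7.2.4}
(`hasEntireLFunction_rat_of_theoremB_of_CDT`) and `AnalyticRankBCDTTheoremBProofs` the finer one
through BCDT §2.2.  Since then the tree acquired the *library* proof line of Theorem B
(`Literature.NumberTheory.Automorphic.BCDTTheoremBOfKhareWintenberger`): Theorem B
(`BCDT.theoremB`, every continuous absolutely irreducible `ρ̄ : G_ℚ → GL₂(𝔽₅)` with cyclotomic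
determinant is modular) follows from Serre's conjecture at `p = 5` — BCDT, Introduction p. 845:
"Serre has conjectured that all odd, irreducible `ρ̄` are strongly modular [Se2]" — now the
theorem of Khare–Wintenberger (Invent. Math. 178 (2009), Thm. 1.2 and Thm. 9.1, with Kisin,
Invent. Math. 178 (2009), Thm. 0.1 / Cor. 0.2 for Hypothesis (H)), vendored as the named fact
`Literature.NumberTheory.Automorphic.khare_wintenberger p k` (strong form (3.2.4)), from which the
weak form (3.2.3) `exists_newform_of_odd_irreducible` and then Theorem B are PROVED in the tree
(`exists_newform_of_odd_irreducible_of_khare_wintenberger`,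
`BCDT.theoremB_of_exists_newform_of_odd_irreducible`, `BCDT.theoremB_of_khare_wintenberger`).

This file composes that line with the proved Hecke layer
(`hasEntireLFunction_rat_of_exists_isNewformOf`) and BCDT Thm. 2.2.2
(`exists_isNewformOf_of_theoremB_of_CDT`), so that the trust base of `hasEntireLFunction_rat`
along the library line is exactly {`khare_wintenberger 5 k` (`k : Type`), `CDT_theorem_7_2_4`}
(or, with CDT Thm. 7.2.4 replaced by its printed inputs, {`khare_wintenberger 5 k`,
`CDT_theorem_7_1_2`, `CDT_theorem_7_2_2`, Ogg–Saito for `V₅ E`}); equivalently the weak form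
(3.2.3) at `p = 5` or Serre's strong conjecture at `p = 5` in place of Khare–Wintenberger.  The
discharge is then
`hasEntireLFunction_rat_holds := hasEntireLFunction_rat_of_khare_wintenberger_of_CDT
  (fun k _ _ _ => khare_wintenberger_holds 5 k) CDT_theorem_7_2_4_holds`
as soon as those two (SIZE XL) discharges exist; nothing else is owed along this line.

No statement of `AnalyticRank.lean` is changed and no named fact is introduced (net debt
delta 0).

## References

* C. Breuil, B. Conrad, F. Diamond, R. Taylor, *On the modularity of elliptic curves over `ℚ`:
  wild 3-adic exercises*, J. Amer. Math. Soc. 14 (2001), 843–939 — Theorems A, B (p. 843),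
  Thms. 2.2.1–2.2.2 (p. 860), Introduction p. 845. [BCDTJAMS2001]
* B. Conrad, F. Diamond, R. Taylor, *Modularity of certain potentially Barsotti–Tate Galois
  representations*, J. Amer. Math. Soc. 12 (1999), 521–567 — Thms. 7.1.2, 7.2.2, 7.2.4 (p. 556).
* C. Khare, J.-P. Wintenberger, *Serre's modularity conjecture (I)*, Invent. Math. 178 (2009),
  485–504, Thm. 1.2 and Thm. 9.1. [KhareWintenberger2009]
* M. Kisin, *Modularity of 2-adic Barsotti–Tate representations*, Invent. Math. 178 (2009),
  587–634, Thm. 0.1, Cor. 0.2. [Kisin2009TwoAdic]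
* J.-P. Serre, *Sur les représentations modulaires de degré 2 de `Gal(ℚ̄/ℚ)`*, Duke Math. J. 54
  (1987), §3.2, (3.2.3)–(3.2.4). [Serre1987]
* F. Diamond, J. Shurman, *A First Course in Modular Forms*, GTM 228, Thm. 8.8.3, Thm. 5.10.2.
-/

noncomputable section

namespace WeierstrassCurve

open Literature.NumberTheory.Automorphic Literature.NumberTheory.Automorphic.BCDT

/-- **`L(E, s)` is entire for every `E / ℚ`, from the Khare–Wintenberger theorem at `p = 5` and
CDT Theorem 7.2.4.**  Khare–Wintenberger (`khare_wintenberger 5 k` for every discrete field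
`k : Type`; the premises "`k` algebraically closed of characteristic `5`" are inside the
proposition) gives BCDT Theorem B (`theoremB_of_khare_wintenberger`); with Conrad–Diamond–Taylor
Thm. 7.2.4 this is BCDT Thm. 2.2.2 = Theorem A, the Modularity Theorem `exists_isNewformOf`
(`exists_isNewformOf_of_khare_wintenberger_of_CDT`), and modularity gives the entire continuation
by Hecke (`hasEntireLFunction_rat_of_exists_isNewformOf`).  Trust base of
`hasEntireLFunction_rat` recorded by this theorem: {`khare_wintenberger 5 k`, `CDT_theorem_7_2_4`}.
[cite: BCDTJAMS2001, Theorem A, Thm. 2.2.2 and Introduction p. 845]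
[cite: KhareWintenberger2009, Thm. 1.2 and Thm. 9.1] -/
theorem hasEntireLFunction_rat_of_khare_wintenberger_of_CDT
    (hKW : ∀ (k : Type) [Field k] [TopologicalSpace k] [DiscreteTopology k],
      khare_wintenberger 5 k)
    (hCDT : CDT_theorem_7_2_4) : hasEntireLFunction_rat :=
  hasEntireLFunction_rat_of_exists_isNewformOf
    (exists_isNewformOf_of_khare_wintenberger_of_CDT hKW hCDT)

/-- **`L(E, s)` is entire for every `E / ℚ`, from the Khare–Wintenberger theorem at `p = 5`, CDT
Theorems 7.1.2 and 7.2.2, and Ogg–Saito for `V₅ E`** (CDT Thm. 7.2.4 replaced by its printed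
inputs, Conrad–Diamond–Taylor 1999, p. 556; the step `27 ∣ N_E ⇒ ρ̄_{E,5}|_{ℚ(√5)}` absolutely
irreducible uses `WeierstrassCurve.artinConductorExponent_tate_eq_conductorExponent_of_isElliptic · 5`
and is proved in `CDTModularityProofs`).  Trust base recorded:
{`khare_wintenberger 5 k`, `CDT_theorem_7_1_2`, `CDT_theorem_7_2_2`, Ogg–Saito at `ℓ = 5`}.
[cite: BCDTJAMS2001, Theorem A and Thm. 2.2.2]
[cite: KhareWintenberger2009, Thm. 1.2 and Thm. 9.1] -/
theorem hasEntireLFunction_rat_of_khare_wintenberger_of_CDT712_722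
    (hKW : ∀ (k : Type) [Field k] [TopologicalSpace k] [DiscreteTopology k],
      khare_wintenberger 5 k)
    (h712 : CDT_theorem_7_1_2) (h722 : CDT_theorem_7_2_2)
    (hOgg : ∀ W : WeierstrassCurve ℚ,
      W.artinConductorExponent_tate_eq_conductorExponent_of_isElliptic 5) :
    hasEntireLFunction_rat :=
  hasEntireLFunction_rat_of_exists_isNewformOf
    (exists_isNewformOf_of_khare_wintenberger_of_CDT712_722 hKW h712 h722 hOgg)

/-- **`L(E, s)` is entire for every `E / ℚ`, from the weak form (3.2.3) of Serre's conjecture at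
`p = 5` and CDT Theorem 7.2.4.**  The weakest Serre-type input the tree offers: every continuous,
irreducible, odd `ρ̄ : G_ℚ → GL₂(k)` (`k` algebraically closed of characteristic `5`) arises from
some newform of some level and weight (`exists_newform_of_odd_irreducible`, Serre 1987 (3.2.3);
a theorem by Khare–Wintenberger); this already gives Theorem B
(`theoremB_of_exists_newform_of_odd_irreducible`: cyclotomic determinant ⇒ odd, absolutely
irreducible ⇒ `ρ̄ ⊗ 𝔽̄₅` irreducible), hence Theorem A with CDT Thm. 7.2.4 and the entire
continuation by Hecke (`hasEntireLFunction_rat_of_theoremB_of_CDT`).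
[cite: BCDTJAMS2001, Theorem B (= Thm. 2.2.1), Thm. 2.2.2 and Introduction p. 845]
[cite: Serre1987, §3.2, (3.2.3)] -/
theorem hasEntireLFunction_rat_of_exists_newform_of_odd_irreducible_of_CDT
    (hSerre : ∀ (k : Type) [Field k] [TopologicalSpace k] [DiscreteTopology k],
      exists_newform_of_odd_irreducible (p := 5) (k := k))
    (hCDT : CDT_theorem_7_2_4) : hasEntireLFunction_rat :=
  hasEntireLFunction_rat_of_theoremB_of_CDT (theoremB_of_exists_newform_of_odd_irreducible hSerre)
    hCDT

/-- **`L(E, s)` is entire for every `E / ℚ`, from Serre's conjecture in its strong form (3.2.4)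
at `p = 5` and CDT Theorem 7.2.4** (`SerreModularityConjecture 5 k` for every discrete field
`k : Type`; by definition `khare_wintenberger 5 k` is this statement, so this is
`hasEntireLFunction_rat_of_khare_wintenberger_of_CDT` read through
`theoremB_of_serreModularityConjecture`).
[cite: BCDTJAMS2001, Theorem A, Thm. 2.2.2 and Introduction p. 845]
[cite: Serre1987, §3.2, (3.2.4)] -/
theorem hasEntireLFunction_rat_of_serreModularityConjecture_of_CDT
    (hSerre : ∀ (k : Type) [Field k] [TopologicalSpace k] [DiscreteTopology k],
      SerreModularityConjecture 5 k)
    (hCDT : CDT_theorem_7_2_4) : hasEntireLFunction_rat :=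
  hasEntireLFunction_rat_of_theoremB_of_CDT (theoremB_of_serreModularityConjecture hSerre) hCDT

/-- **Per curve.** For a single elliptic `W / ℚ`, `W.HasEntireLFunction` from the
Khare–Wintenberger theorem at `p = 5` and CDT Thm. 7.2.4 (specialisation of
`hasEntireLFunction_rat_of_khare_wintenberger_of_CDT`).
[cite: BCDTJAMS2001, Theorem A and Thm. 2.2.2]
[cite: KhareWintenberger2009, Thm. 1.2 and Thm. 9.1] -/
theorem hasEntireLFunction_of_khare_wintenberger_of_CDT
    (hKW : ∀ (k : Type) [Field k] [TopologicalSpace k] [DiscreteTopology k],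
      khare_wintenberger 5 k)
    (hCDT : CDT_theorem_7_2_4) (W : WeierstrassCurve ℚ) [W.IsElliptic] : W.HasEntireLFunction :=
  hasEntireLFunction_rat_of_khare_wintenberger_of_CDT hKW hCDT W

end WeierstrassCurve

end
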